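import Mathlib.Algebra.MonoidAlgebra.Basic
import Mathlib.Algebra.MonoidAlgebra.Support
import Mathlib.Algebra.MonoidAlgebra.Module
import Mathlib.Algebra.MvPolynomial.CommRing
import Mathlib.Algebra.MvPolynomial.NoZeroDivisors
import Literature.Computability.MetaComplexity.XorPseudoexpectation
import Summits.PneNP.PneNP.Theorems.ExpanderLinearGeneratorsPolyCalcSigns
import HarnessLib

/-!
# Arithmetisation over a field of characteristic `≠ 2`: the group algebra `K[ParityVec]` and
`x_v ↦ (1 - y_v)/2`

Support file for item `stmt-PneNP-11444` (`LinearGeneratorModPFregeHard`), second part of the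
POLYNOMIAL CALCULUS RUNG (`…PolyCalcDegree.lean`).  `Literature/…/XorPseudoexpectation.lean`
arithmetises CNFs over `ℝ` for the Grigoriev–Schoenebeck SOS lower bound: the group algebra
`ℝ[ParityVec]` of multilinear `±1`-polynomials, the homomorphism `phi : x_v ↦ (1 - y_v)/2` and
its degree control.  The polynomial calculus over `𝔽_p` needs the same over an arbitrary field `K`
with `2 ≠ 0`; this file is that transcription (the clause polynomials and the clause identity
follow in `…PolyCalcClauses.lean`):

* `ParityAlgK K = K[ParityVec]`, monomials `ymon T a`, `momentFunctionalK e` (`y_T ↦ e T`) and its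
  values on products, the coefficient of a translate (`coeff_ySingle_mul`);
* `phiXK v = (1 - y_v)/2`, `phiK : MvPolynomial ℕ K →ₐ[K] ParityAlgK K`; Booleanity dies
  (`phiK_boolAxiom`, needs `2 ≠ 0`);
* degree control through the variable set `varsOf x` of an element of the group algebra:
  `card_support_le_totalDegree_phiK` — every monomial `y_T` of `phiK p` has `|T| ≤ deg p`.

Sources: D. Grigoriev, TCS 259 (2001) §2; S. Buss, D. Grigoriev, R. Impagliazzo, T. Pitassi,
JCSS 62 (2001) §3 (Fourier basis for PC in characteristic `≠ 2`).  Adapted from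
`Literature/Computability/MetaComplexity/XorPseudoexpectation.lean` (real-valued version).
-/

noncomputable section

set_option linter.dupNamespace false -- `Summit.PneNP.PneNP.…`: summit = sub-problem (D-0017)

namespace Summit.PneNP.PneNP.Theorems.PolyCalc

open Finset MvPolynomial Literature.Computability.Complexity Literature.Computability.MetaComplexity
open scoped symmDiff

/-! ### The group algebra over `K` and the moment functional -/

section Algebra

variable (K : Type*) [Field K]

/-- The group algebra `K[ParityVec]` of the Boolean group of parity vectors: multilinear
polynomials in `±1`-valued variables with coefficients in `K`. [Buss–Grigoriev–Impagliazzo–Pitassi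
2001, §3 (Fourier basis)] [folklore] -/
abbrev ParityAlgK : Type _ := AddMonoidAlgebra K ParityVec

variable {K}

/-- The monomial `y_T` with coefficient `a`, as an element of `K[ParityVec]`. [folklore] -/
abbrev ymon (T : ParityVec) (a : K) : ParityAlgK K := AddMonoidAlgebra.single T a

/-- `y_T · y_U = y_{T+U}` with coefficients. [folklore] -/
theorem ymon_mul (T U : ParityVec) (a a' : K) : ymon T a * ymon U a' = ymon (T + U) (a * a') :=
  AddMonoidAlgebra.single_mul_single ..

/-- The MOMENT FUNCTIONAL of a `K`-valued moment sequence `e`: `y_T ↦ e T`.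
[Grigoriev 2001, §2] [folklore] -/
def momentFunctionalK (e : ParityVec → K) : ParityAlgK K →ₗ[K] K :=
  Finsupp.linearCombination K e ∘ₗ (AddMonoidAlgebra.coeffLinearEquiv K).toLinearMap

/-- Value on a monomial. [folklore] -/
@[simp] theorem momentFunctionalK_single (e : ParityVec → K) (T : ParityVec) (a : K) :
    momentFunctionalK e (ymon T a) = a * e T := by
  simp [momentFunctionalK, Finsupp.linearCombination_single]

/-- Value on a product: `L(x z) = Σ_{T,U} x_T z_U e(T + U)`. [folklore] -/
theorem momentFunctionalK_mul (e : ParityVec → K) (x z : ParityAlgK K) :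
    momentFunctionalK e (x * z) =
      ∑ T ∈ x.coeff.support, ∑ U ∈ z.coeff.support, x.coeff T * z.coeff U * e (T + U) := by
  rw [AddMonoidAlgebra.mul_def, map_finsuppSum, Finsupp.sum]
  refine Finset.sum_congr rfl fun T _ => ?_
  rw [map_finsuppSum, Finsupp.sum]
  refine Finset.sum_congr rfl fun U _ => ?_
  rw [momentFunctionalK_single]

/-- Value on `y_T · z`. [folklore] -/
theorem momentFunctionalK_single_mul (e : ParityVec → K) (T : ParityVec) (a : K)
    (z : ParityAlgK K) :
    momentFunctionalK e (ymon T a * z) = ∑ U ∈ z.coeff.support, a * z.coeff U * e (T + U) := by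
  classical
  rw [momentFunctionalK_mul]
  by_cases ha : a = 0
  · subst ha
    simp
  · rw [AddMonoidAlgebra.coeff_single, Finsupp.support_single _ ha, Finset.sum_singleton,
      Finsupp.single_eq_same]

/-- In the Boolean group `-T = T`. [folklore] -/
@[simp] theorem ParityVec.neg_eq (T : ParityVec) : -T = T :=
  neg_eq_of_add_eq_zero_left (ParityVec.add_self T)

/-- **Coefficients of a translate**: `(y_S · v)_W = v_{S + W}`. [folklore] -/
theorem coeff_ySingle_mul (S : ParityVec) (v : ParityAlgK K) (W : ParityVec) :
    (ymon S (1 : K) * v).coeff W = v.coeff (S + W) := by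
  rw [AddMonoidAlgebra.coeff_single_mul_apply, one_mul, ParityVec.neg_eq]

/-! ### The arithmetisation `x_v ↦ (1 - y_v)/2` -/

/-- The image of the `0/1` variable `x_v`: `(1 - y_v)/2`. [Buss–Grigoriev–Impagliazzo–Pitassi
2001, §3; Grigoriev 2001, §2] [folklore] -/
def phiXK (v : ℕ) : ParityAlgK K :=
  (1 / 2 : K) • (1 - ymon (Finsupp.single v 1) (1 : K))

variable (K) in
/-- The arithmetisation homomorphism `K[x_v : v ∈ ℕ] → K[ParityVec]`, `x_v ↦ (1 - y_v)/2`.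
[Buss–Grigoriev–Impagliazzo–Pitassi 2001, §3] [folklore] -/
def phiK : MvPolynomial ℕ K →ₐ[K] ParityAlgK K :=
  MvPolynomial.aeval phiXK

/-- `phiK (x_v) = (1 - y_v)/2`. [folklore] -/
@[simp] theorem phiK_X (v : ℕ) : phiK K (X v) = phiXK v :=
  MvPolynomial.aeval_X _ _

/-- `((1 - y_v)/2)² = (1 - y_v)/2` (`y_v² = 1`; needs `2 ≠ 0`). [Grigoriev 2001, §2] [folklore] -/
theorem phiXK_mul_self (h2 : (2 : K) ≠ 0) (v : ℕ) : phiXK (K := K) v * phiXK v = phiXK v := by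
  unfold phiXK
  set Y : ParityAlgK K := ymon (Finsupp.single v 1) (1 : K) with hYdef
  have hY : Y * Y = 1 := by
    rw [hYdef, ymon_mul, ParityVec.add_self, mul_one, AddMonoidAlgebra.one_def]
  rw [Algebra.smul_def]
  set C := algebraMap K (ParityAlgK K) (1 / 2 : K) with hC
  have h2C : 2 * C = 1 := by
    rw [hC, show (2 : ParityAlgK K) = algebraMap K (ParityAlgK K) 2 from (map_ofNat _ 2).symm,
      ← map_mul, show (2 : K) * (1 / 2) = 1 from mul_one_div_cancel h2, map_one]
  linear_combination C ^ 2 * hY + (1 - Y) * C * h2C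

/-- The Booleanity axioms die under `phiK`: `phiK (x_v² - x_v) = 0`. [Grigoriev 2001, §2]
[folklore] -/
theorem phiK_boolAxiom (h2 : (2 : K) ≠ 0) (v : ℕ) :
    phiK K (X v ^ 2 - X v : MvPolynomial ℕ K) = 0 := by
  rw [map_sub, map_pow, phiK_X, sq, phiXK_mul_self h2, sub_self]

/-! ### Degree control: `phiK` does not create long monomials -/

/-- The set of variables occurring in the monomials `y_T` of `x`. [folklore] -/
def varsOf (x : ParityAlgK K) : Finset ℕ :=
  x.coeff.support.biUnion Finsupp.support

/-- `varsOf x ⊆ B` iff every monomial of `x` has its variables in `B`. [folklore] -/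
theorem varsOf_subset_iff {B : Finset ℕ} {x : ParityAlgK K} :
    varsOf x ⊆ B ↔ ∀ T ∈ x.coeff.support, T.support ⊆ B :=
  Finset.biUnion_subset

/-- A monomial of `x` has its variables in `varsOf x`. [folklore] -/
theorem support_subset_varsOf {x : ParityAlgK K} {T : ParityVec} (hT : T ∈ x.coeff.support) :
    T.support ⊆ varsOf x :=
  varsOf_subset_iff.1 (subset_refl _) T hT

/-- `single T a` involves only the variables of `T`. [folklore] -/
theorem varsOf_single {B : Finset ℕ} {T : ParityVec} (hT : T.support ⊆ B) (a : K) :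
    varsOf (ymon T a) ⊆ B := by
  rw [varsOf_subset_iff]
  intro U hU
  rw [AddMonoidAlgebra.coeff_single] at hU
  have := Finsupp.support_single_subset hU
  rw [Finset.mem_singleton] at this
  rwa [this]

/-- `1` involves no variable. [folklore] -/
theorem varsOf_one (B : Finset ℕ) : varsOf (1 : ParityAlgK K) ⊆ B := by
  rw [AddMonoidAlgebra.one_def]
  exact varsOf_single (by simp) 1

/-- Sums. [folklore] -/
theorem varsOf_add {B : Finset ℕ} {x z : ParityAlgK K} (hx : varsOf x ⊆ B) (hz : varsOf z ⊆ B) :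
    varsOf (x + z) ⊆ B := by
  rw [varsOf_subset_iff] at *
  intro T hT
  rw [AddMonoidAlgebra.coeff_add] at hT
  rcases Finset.mem_union.1 (Finsupp.support_add hT) with h | h
  · exact hx T h
  · exact hz T h

/-- Negation. [folklore] -/
theorem varsOf_neg {B : Finset ℕ} {x : ParityAlgK K} (hx : varsOf x ⊆ B) : varsOf (-x) ⊆ B := by
  rw [varsOf_subset_iff] at *
  intro T hT
  rw [AddMonoidAlgebra.coeff_neg, Finsupp.support_neg] at hT
  exact hx T hT

/-- Differences. [folklore] -/
theorem varsOf_sub {B : Finset ℕ} {x z : ParityAlgK K} (hx : varsOf x ⊆ B) (hz : varsOf z ⊆ B) :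
    varsOf (x - z) ⊆ B := by
  rw [sub_eq_add_neg]; exact varsOf_add hx (varsOf_neg hz)

/-- Scalar multiples. [folklore] -/
theorem varsOf_smul {B : Finset ℕ} {x : ParityAlgK K} (hx : varsOf x ⊆ B) (a : K) :
    varsOf (a • x) ⊆ B := by
  rw [varsOf_subset_iff] at *
  intro T hT
  rw [AddMonoidAlgebra.coeff_smul] at hT
  exact hx T (Finsupp.support_smul hT)

/-- Products: variable sets unite (`y_T y_U = y_{T+U}`). [folklore] -/
theorem varsOf_mul {B B' : Finset ℕ} {x z : ParityAlgK K} (hx : varsOf x ⊆ B) (hz : varsOf z ⊆ B') :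
    varsOf (x * z) ⊆ B ∪ B' := by
  classical
  rw [varsOf_subset_iff] at *
  intro T hT
  have := AddMonoidAlgebra.support_coeff_mul_subset x z hT
  rw [Finset.mem_add] at this
  obtain ⟨T₁, hT₁, T₂, hT₂, rfl⟩ := this
  exact Finsupp.support_add.trans (Finset.union_subset_union (hx T₁ hT₁) (hz T₂ hT₂))

/-- Powers. [folklore] -/
theorem varsOf_pow {B : Finset ℕ} {x : ParityAlgK K} (hx : varsOf x ⊆ B) :
    ∀ n : ℕ, varsOf (x ^ n) ⊆ B
  | 0 => by rw [pow_zero]; exact varsOf_one B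
  | n + 1 => by
    rw [pow_succ]
    simpa using varsOf_mul (varsOf_pow hx n) hx

/-- Finite products: variable sets unite. [folklore] -/
theorem varsOf_prod {κ : Type*} [DecidableEq κ] {B : κ → Finset ℕ} {s : Finset κ}
    {f : κ → ParityAlgK K} (h : ∀ i ∈ s, varsOf (f i) ⊆ B i) :
    varsOf (∏ i ∈ s, f i) ⊆ s.biUnion B := by
  induction s using Finset.induction_on with
  | empty => rw [Finset.prod_empty]; exact varsOf_one _
  | insert a s ha ih =>
    rw [Finset.prod_insert ha, Finset.biUnion_insert]
    exact varsOf_mul (h a (Finset.mem_insert_self a s)) (ih fun i hi => h i (Finset.mem_insert_of_mem hi))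

/-- `phiK (x_v)` only involves the variable `v`. [folklore] -/
theorem varsOf_phiXK (v : ℕ) : varsOf (phiXK (K := K) v) ⊆ {v} := by
  unfold phiXK
  exact varsOf_smul (varsOf_sub (varsOf_one _) (varsOf_single Finsupp.support_single_subset 1)) _

/-- `phiK` of a monomial `x^α` only involves the variables of `α`. [folklore] -/
theorem varsOf_phiK_monomial (α : ℕ →₀ ℕ) (a : K) :
    varsOf (phiK K (monomial α a)) ⊆ α.support := by
  classical
  rw [phiK, MvPolynomial.aeval_monomial, Finsupp.prod]
  have h1 : varsOf (algebraMap K (ParityAlgK K) a) ⊆ ∅ := by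
    rw [AddMonoidAlgebra.coe_algebraMap, Function.comp_apply, Algebra.algebraMap_self_apply]
    exact varsOf_single (by simp) a
  have h2 : varsOf (∏ v ∈ α.support, phiXK (K := K) v ^ α v) ⊆ α.support.biUnion fun v => {v} :=
    varsOf_prod fun v _ => varsOf_pow (varsOf_phiXK v) _
  rw [Finset.biUnion_singleton_eq_self] at h2
  simpa using varsOf_mul h1 h2

/-- **Degree control.** Every monomial `y_T` of `phiK p` has `|T| ≤ deg p`.
[Buss–Grigoriev–Impagliazzo–Pitassi 2001, §3; Grigoriev 2001, §2] [folklore] -/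
theorem card_support_le_totalDegree_phiK (p : MvPolynomial ℕ K) {T : ParityVec}
    (hT : T ∈ (phiK K p).coeff.support) : T.support.card ≤ p.totalDegree := by
  classical
  rw [p.as_sum, map_sum, AddMonoidAlgebra.coeff_sum] at hT
  obtain ⟨α, hα, hTα⟩ := Finset.mem_biUnion.1 (Finsupp.support_finsetSum hT)
  have hsub : T.support ⊆ α.support :=
    (varsOf_subset_iff.1 (varsOf_phiK_monomial α _)) T hTα
  refine (Finset.card_le_card hsub).trans (le_trans ?_ (MvPolynomial.le_totalDegree hα))
  rw [Finsupp.sum, Finset.card_eq_sum_ones]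
  exact Finset.sum_le_sum fun v hv => Nat.one_le_iff_ne_zero.2 (Finsupp.mem_support_iff.1 hv)

end Algebra

end Summit.PneNP.PneNP.Theorems.PolyCalc
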